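import Summits.CriticalPhenomena.PercolationContinuityZ3.Theses.PercLowPointHalfSpace
import Summits.CriticalPhenomena.PercolationContinuityZ3.Theorems.TallClusterMassBound.Negative.MassExponentFamily
import Literature.Probability.Percolation.SharpnessDCTProofs
import Literature.Probability.Percolation.ConnectivityThetaSqProofs
import Literature.Probability.Percolation.TwoPointFunction

/-!
# Crux-triage r1 (triager 3) evidence for `TallClusterMassBound` (stmt-CriticalPhenomena-0912)

Two of the five round-1 ideas TRANSFER the crux B to a BULK density hypothesis:
* card `gladkov-schur-second-moment-transfer`, hypothesis (i) `SqrtSusceptibilityBound μ C`: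
  `Ξ(n) := Σ_{z ∈ B_n} √τ_{p_c}(0,z) ≤ C n^{11/4 - μ}`;
* card `quarter-arm-transfer`, hypothesis `OneArmQuarter`: `P_{p_c}(0 ↔ ∂B_n) ≤ C n^{-1/4-ε}`.

Checked here (rc 0, no sorry): EACH of these hypotheses closes the summit conjunct
`PercolationContinuityZ3` (`θ(p_c) = 0`) BY ITSELF in a few lines — (i) via `τ ≥ θ²`
(`Grimmett1999_theta_sq_le_openConn_holds`, in tree), the one-arm rate via `θ ≤ P(0 ↔ ∂B_n)`
(`DCT16.theta_le_real_siteToBoundary`, in tree). So a line built on either hypothesis makes the rest of route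
PercLowPointHalfSpace (cruxes A, C, the low-point identity, the assembly) redundant: it relocates the crux into a
quantitative strengthening of the summit rather than towards it. This is the formal content of the triage remark
"bulk relocation"; it refutes nothing.
-/

noncomputable section

open MeasureTheory Filter
open Literature.Probability.Percolation Literature.Probability.LatticeModels
open Summit.CriticalPhenomena.PercolationContinuityZ3.Theorems.TallClusterMassBound.Negative (not_forall_rpow_le)

namespace Summit.CriticalPhenomena.PercolationContinuityZ3.Cruxes.TallClusterMassBound.Triage3

/-- `Ξ(n) = Σ_{z ∈ B_n} √τ_{p_c}(0,z)` (card gladkov-schur's `sqrtSusc`, same formula). [folklore] -/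
def sqrtSusc (n : ℕ) : ℝ := ∑ z ∈ box 3 n, Real.sqrt (tau 3 (criticalProbI 3) 0 z)

/-- Sub-volume growth of `Ξ`: `Ξ(n) ≤ C n^s` for all `n ≥ 1`, some `s < 3`. Card gladkov-schur's hypothesis (i)
`SqrtSusceptibilityBound μ C` (exponent `11/4 - μ`, `μ ≥ 0`) is the case `s = 11/4 - μ < 3`. [folklore] -/
def SqrtSuscSubvolume : Prop :=
  ∃ C s : ℝ, s < 3 ∧ ∀ n : ℕ, 1 ≤ n → sqrtSusc n ≤ C * (n : ℝ) ^ s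

/-- A polynomial one-arm RATE at `p_c(ℤ³)`: `P_{p_c}(0 ↔ ∂B_n) ≤ C n^{-a}`, some `a > 0`. Card quarter-arm's
`OneArmQuarter` is the case `a = 1/4 + ε`. [folklore] -/
def OneArmRate : Prop :=
  ∃ C a : ℝ, 0 < a ∧ ∀ n : ℕ, 1 ≤ n →
    (bondPercolation (zdGraph 3) (criticalProbI 3)).real (siteToBoundary 3 n) ≤ C * (n : ℝ) ^ (-a)

/-- `θ(p_c) · (2n+1)³ ≤ Ξ(n)`: `θ² ≤ τ(0,z)` termwise (FKG + uniqueness, Grimmett §8.5; in tree). [folklore] -/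
theorem theta_mul_card_le_sqrtSusc (n : ℕ) :
    theta (zdGraph 3) 0 (criticalProbI 3) * (2 * (n : ℝ) + 1) ^ 3 ≤ sqrtSusc n := by
  have hθ : 0 ≤ theta (zdGraph 3) (0 : Site 3) (criticalProbI 3) := measureReal_nonneg
  have h : ∀ z : Site 3, theta (zdGraph 3) 0 (criticalProbI 3) ≤ Real.sqrt (tau 3 (criticalProbI 3) 0 z) := by
    intro z
    have h2 := Grimmett1999_theta_sq_le_openConn_holds 3 (criticalProbI 3) 0 z
    rw [← tau_def] at h2
    calc theta (zdGraph 3) 0 (criticalProbI 3)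
        = Real.sqrt (theta (zdGraph 3) 0 (criticalProbI 3) ^ 2) := by rw [Real.sqrt_sq hθ]
      _ ≤ Real.sqrt (tau 3 (criticalProbI 3) 0 z) := Real.sqrt_le_sqrt h2
  calc theta (zdGraph 3) 0 (criticalProbI 3) * (2 * (n : ℝ) + 1) ^ 3
      = ∑ _z ∈ box 3 n, theta (zdGraph 3) 0 (criticalProbI 3) := by
        rw [Finset.sum_const, nsmul_eq_mul, card_box]; push_cast; ring
    _ ≤ sqrtSusc n := Finset.sum_le_sum fun z _ => h z

/-- RELOCATION 1: hypothesis (i) of card gladkov-schur (any sub-volume exponent `s < 3`) closes the SUMMIT by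
itself: `Ξ(n) ≤ C n^s`, `θ (2n+1)³ ≤ Ξ(n)` and `s < 3` force `θ(p_c) = 0`. [folklore] -/
theorem summit_of_sqrtSuscSubvolume (h : SqrtSuscSubvolume) : _root_.PercolationContinuityZ3 := by
  obtain ⟨C, s, hs, hC⟩ := h
  rw [_root_.PercolationContinuityZ3, Literature.Probability.Percolation.PercolationContinuityZ3,
    PercolationContinuity]
  set θ : ℝ := theta (zdGraph 3) (0 : Site 3) (criticalProbI 3) with hθdef
  have hθ0 : 0 ≤ θ := measureReal_nonneg
  by_contra hne
  have hθpos : 0 < θ := lt_of_le_of_ne hθ0 (Ne.symm hne)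
  refine not_forall_rpow_le (c := θ) (C := C) (s := s) (t := 3) hθpos hs fun n hn => ?_
  have h1 := (theta_mul_card_le_sqrtSusc n).trans (hC n hn)
  have hn' : (1 : ℝ) ≤ n := by exact_mod_cast hn
  have h3 : (n : ℝ) ^ (3 : ℝ) = (n : ℝ) ^ (3 : ℕ) := by exact_mod_cast Real.rpow_natCast (n : ℝ) 3
  have hle : (n : ℝ) ^ (3 : ℕ) ≤ (2 * (n : ℝ) + 1) ^ 3 := pow_le_pow_left₀ (by linarith) (by linarith) 3
  rw [h3]
  calc θ * (n : ℝ) ^ (3 : ℕ) ≤ θ * (2 * (n : ℝ) + 1) ^ 3 := mul_le_mul_of_nonneg_left hle hθ0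
    _ ≤ C * (n : ℝ) ^ s := h1

/-- RELOCATION 2: a one-arm rate at `p_c(ℤ³)` (card quarter-arm's `OneArmQuarter` is the rate `1/4 + ε`) closes the
SUMMIT by itself: `θ ≤ P(0 ↔ ∂B_n) ≤ C n^{-a} → 0`. [folklore] -/
theorem summit_of_oneArmRate (h : OneArmRate) : _root_.PercolationContinuityZ3 := by
  obtain ⟨C, a, ha, hC⟩ := h
  rw [_root_.PercolationContinuityZ3, Literature.Probability.Percolation.PercolationContinuityZ3,
    PercolationContinuity]
  refine le_antisymm ?_ measureReal_nonneg
  have hlim : Tendsto (fun n : ℕ => C * (n : ℝ) ^ (-a)) atTop (nhds 0) := by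
    have h1 : Tendsto (fun n : ℕ => (n : ℝ) ^ (-a)) atTop (nhds 0) :=
      (tendsto_rpow_neg_atTop ha).comp tendsto_natCast_atTop_atTop
    simpa using h1.const_mul C
  refine ge_of_tendsto hlim ?_
  filter_upwards [eventually_ge_atTop 1] with n hn
  exact (DCT16.theta_le_real_siteToBoundary (d := 3) (criticalProbI 3) n).trans (hC n hn)

end Summit.CriticalPhenomena.PercolationContinuityZ3.Cruxes.TallClusterMassBound.Triage3
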